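import Literature.NumberTheory.GaloisRepresentations.CompletionCompositumEmbeddingTower
import Literature.NumberTheory.NumberFields.SemilocalPrincipalUnitsPlacesTower
import HarnessLib

/-!
# Local norms at EQUAL lower places agree up to the identity transport `galAdicCompletionMap 1`, and the `placeUnder`/`placeOver` currency of the
# semi-local tower files versus the `embPlace`/`embPlaceOver` currency of the compositum model (Cassels–Fröhlich II §10–§11, VII §1.1)

Topic `NumberTheory/GaloisRepresentations`; namespace `Literature.NumberTheory.GaloisRepresentations.SemiLocal`.  Glue (memo BRICK-C-LOCALMODEL-g23 F46): the D5 files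
(`EllipticUnits/SemilocalUnitTowerCoinvOrbitsNorm.coe_proj_repr_normUPlace_placeLift`) write the transition of Rubin's `U_∞` on an orbit factor as
`galAdicCompletionMap (φ t)⁻¹ (N x)` with the local norm for the place `Semilocal.placeOver w'` above the LOWER place `(Semilocal.placeUnder w').1 = w'.1.under (𝓞 L)`
(a definitional `comap`), while the local model (`CompletionCompositumEmbeddingTower`, `NumberFields/RayClassFieldLocalTowerCoherentUnits`,
`EllipticCurves/PAdicTwoVariableLocalUnits*`) writes it for the place `embPlaceOver v L L' h` above the distinguished `embPlace v L.val` — equal to that `comap` by the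
THEOREM `under_embPlace_eq`, not definitionally.  THIS file supplies the transport:

* ★ `galAdicCompletionMap_one_norm_algebraPlace` — for a place `w'` of `L'` and two EQUAL places `w₁ = w₂` of `L` below it, the local norms `N_{L'_{w'}/L_{w₁}}` and
  `N_{L'_{w'}/L_{w₂}}` (`algebraPlace ⟨w', _⟩`) agree up to `galAdicCompletionMap 1 : L_{w₁} → L_{w₂}` (by `subst`: the identity transport `galAdicCompletionMap_one`);
* ★ `placeUnder_embPlace` — `Semilocal.placeUnder K v L L' 𝔓(L') = 𝔓(L)` in `v.Extension (𝓞 L)` (`𝔓 = embPlace` read through `extensionEquivPlace`), `one_smul_placeUnder_embPlace`;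
* ★★ **`galAdicCompletionMap_one_norm_placeOver_embPlace`** — `galAdicCompletionMap 1 _ (N_{placeOver 𝔓(L')} x) = N_{embPlaceOver} x`: the D5 transition value at the chosen
  base places `w₀ := 𝔓 = embPlace` (with `t = 1`) IS the local norm of the local model, on the nose.

Theorems only; no definition, no named fact, no instance, no `sorry`.

## References
* [CasselsFrohlichANT1967] J. W. S. Cassels, A. Fröhlich (eds.), *Algebraic Number Theory* (1967), Ch. II §10–§11; Ch. VII §1.1.
-/

noncomputable section

open NumberField IsDedekindDomain IntermediateField Field
open scoped Valued

namespace Literature.NumberTheory.GaloisRepresentations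

namespace SemiLocal

open Literature.NumberTheory.Automorphic Literature.NumberTheory.NumberFields LocalWeilDatum

section Transport

variable {K : Type} [Field K] [NumberField K] {L : Type} [Field L] [NumberField L] [Algebra K L]
  {L' : Type} [Field L'] [NumberField L'] [Algebra L L']

omit [NumberField K] in
/-- ★ **Local norms at equal lower places agree up to the identity transport**: for a place `w'` of `L'`, places `w₁ = w₂` of `L` with `w' ∣ w₁`, `w' ∣ w₂`, and
`x ∈ L'_{w'}`: `galAdicCompletionMap 1 (N_{L'_{w'}/L_{w₁}} x) = N_{L'_{w'}/L_{w₂}} x` (`subst` + `galAdicCompletionMap_one`). [cite: CasselsFrohlichANT1967, Ch. II §11] -/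
theorem galAdicCompletionMap_one_norm_algebraPlace (w' : HeightOneSpectrum (𝓞 L')) {w₁ w₂ : HeightOneSpectrum (𝓞 L)}
    (h₁ : w'.under (𝓞 L) = w₁) (h₂ : w'.under (𝓞 L) = w₂) (h : (1 : L ≃ₐ[K] L) • w₁ = w₂) (x : w'.adicCompletion L') :
    galAdicCompletionMap (1 : L ≃ₐ[K] L) h (@Algebra.norm (w₁.adicCompletion L) (w'.adicCompletion L') _ _ (algebraPlace (⟨w', h₁⟩ : Place L L' w₁)) x) =
      @Algebra.norm (w₂.adicCompletion L) (w'.adicCompletion L') _ _ (algebraPlace (⟨w', h₂⟩ : Place L L' w₂)) x := by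
  subst h₁; subst h₂
  rw [galAdicCompletionMap_one]

end Transport

section EmbPlace

variable {K : Type} [Field K] [NumberField K] (v : HeightOneSpectrum (𝓞 K))
  (L L' : IntermediateField K (AlgebraicClosure K)) [NumberField L] [NumberField L']
  [IsGalois K L] [IsGalois K L'] (hLL' : L ≤ L')

/-- ★ **`placeUnder 𝔓(L') = 𝔓(L)`**: the semi-local tower files' `Semilocal.placeUnder` of the distinguished place of `L'` is the distinguished place of `L` (read in
`v.Extension (𝓞 L)` through `Semilocal.extensionEquivPlace`; the algebra `L → L'` is ty2's `Semilocal.inclusionAlgebra` = the inclusion). [cite: CasselsFrohlichANT1967, Ch. II §10] -/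
theorem placeUnder_embPlace :
    letI := towerAlgebra hLL'
    Semilocal.placeUnder K v L L' ((Semilocal.extensionEquivPlace K v L').symm (embPlace v L'.val)) =
      (Semilocal.extensionEquivPlace K v L).symm (embPlace v L.val) := by
  letI := towerAlgebra hLL'
  exact Subtype.ext (under_embPlace_eq v L L' hLL')

/-- `1 • 𝔓(L')∩L = 𝔓(L)` in the places of `L` (the hypothesis shape of `galAdicCompletionMap 1`). [cite: CasselsFrohlichANT1967, Ch. VII §1.1] -/
theorem one_smul_under_embPlace :
    letI := towerAlgebra hLL'
    (1 : L ≃ₐ[K] L) • ((embPlace v L'.val : Place K L' v) : HeightOneSpectrum (𝓞 L')).under (𝓞 L) =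
      ((embPlace v L.val : Place K L v) : HeightOneSpectrum (𝓞 L)) := by
  letI := towerAlgebra hLL'
  rw [one_smul]
  exact under_embPlace_eq v L L' hLL'

/-- ★★ **The D5 transition value at the base places `𝔓 = embPlace` IS the local norm of the local model**: with `w' := 𝔓(L')` (as an element of `v.Extension (𝓞 L')`),
`galAdicCompletionMap 1 _ (N_{algebraPlace (placeOver w')} x) = N_{algebraPlace (embPlaceOver v L L' h)} x` — the currency of `SemilocalUnitTowerCoinvOrbitsNorm` (`t = 1`,
`σ = 1`) meets the currency of `RayClassFieldLocalTowerCoherentUnits.norm_toAdicCompletion` / `PAdicTwoVariableLocalUnits*.norm_*ToAdicCompletion`.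
[cite: CasselsFrohlichANT1967, Ch. II §11; Ch. VII §1.1] -/
theorem galAdicCompletionMap_one_norm_placeOver_embPlace
    (x : (((embPlace v L'.val : Place K L' v) : HeightOneSpectrum (𝓞 L'))).adicCompletion L') :
    letI := towerAlgebra hLL'
    galAdicCompletionMap (1 : L ≃ₐ[K] L) (one_smul_under_embPlace v L L' hLL')
        (@Algebra.norm ((Semilocal.placeUnder K v L L' ((Semilocal.extensionEquivPlace K v L').symm (embPlace v L'.val))).1.adicCompletion L)
          (((embPlace v L'.val : Place K L' v) : HeightOneSpectrum (𝓞 L')).adicCompletion L') _ _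
          (algebraPlace (Semilocal.placeOver K v L L' ((Semilocal.extensionEquivPlace K v L').symm (embPlace v L'.val)))) x) =
      @Algebra.norm (((embPlace v L.val : Place K L v) : HeightOneSpectrum (𝓞 L)).adicCompletion L)
        (((embPlace v L'.val : Place K L' v) : HeightOneSpectrum (𝓞 L')).adicCompletion L') _ _ (algebraPlace (embPlaceOver v L L' hLL')) x := by
  letI := towerAlgebra hLL'
  exact galAdicCompletionMap_one_norm_algebraPlace (K := K) _ rfl (under_embPlace_eq v L L' hLL') (one_smul_under_embPlace v L L' hLL') x

end EmbPlace

end SemiLocal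

end Literature.NumberTheory.GaloisRepresentations

end
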